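/-
Copyright (c) 2026 the pub-hodgecm-mathlib formalisation cell (harness21).  Prover seat hodgecm-mathlib-K2E1-p14 (g0), Track B «K2-LIT» ENGINE E1, h413 =
`stmt-HodgeConjecture-24833`, route `HCCMUnconditional`, campaign «5Res» (b) — letter (ℓ2) of the (χ,τ) chain, dealer K2E1-plan (g7) 12:32Z «(ℓ2) evaluation-matrix lemma «=»».
-/
import Mathlib
import Literature.NumberTheory.EllipticCurves.ModularSymbolsPeriodHomology   -- ★ `exists_finset_iInf_eq` (a finite sub-infimum attains an infimum of subspaces)
import Literature.AlgebraicGeometry.Smoothening.JacobianLift               -- ★ `exists_submatrix_det_ne_zero_of_linearIndependent` (row rank = column rank)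
import HarnessLib

/-!
# h413 ∕ Track B «K2-LIT», 5Res (b) — `K2E1LinearIndependentEvalMatrix`: EVALUATION POINTS WITH INVERTIBLE MATRIX FOR A LINEARLY INDEPENDENT FINITE FAMILY OF FUNCTIONS, AND
# HOLOMORPHY OF THE COORDINATES OF A POINTWISE-HOLOMORPHIC FAMILY IN ITS SPAN

Cell `pub/hodgecm-mathlib`, crux H413 = `stmt-HodgeConjecture-24833`; dealer K2E1-plan (g7) (12:32Z).  THEOREMS ONLY (no `def`, no `instance`, no `notation`, no named-fact hypothesis,
no `sorry`); lane `--kind proof --supports stmt-HodgeConjecture-24833 --as helper` (count-neutral).  Mathlib + two ★ Literature folklore lemmas.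

THE MATHEMATICS (linear algebra, folklore).  (1) If `φ_j : X → 𝕜` (`j ∈ ι` finite) are linearly independent over a field `𝕜`, there are points `g_k ∈ X` (`k ∈ ι`) with
`det (φ_j(g_k))_{j,k} ≠ 0`: the kernels `W_x = {c : Σ_j c_j φ_j(x) = 0}` of the evaluations on the coefficient space `𝕜^ι` have `⋂_x W_x = 0`; in the finite-dimensional `𝕜^ι` a FINITE
sub-intersection is already `0` (★ `exists_finset_iInf_eq`), so the `ι × s` matrix `(φ_j(x))_{j, x ∈ s}` has independent rows and hence an invertible `ι × ι` minor (★
`exists_submatrix_det_ne_zero_of_linearIndependent`).  (2) Consequently the coordinates of any `v ∈ span φ` are FIXED linear combinations of the values `v(g_k)` (Cramer: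
`c = (Mᵀ)⁻¹ (v(g_k))_k`), so a family `z ↦ v_z ∈ span φ` whose values `z ↦ v_z(x)` are holomorphic on `S` has holomorphic coordinates `q_j` on `S` with `Σ_j q_j(z) φ_j = v_z`.
USE: the letter `hq∕hqφ` of ★ `chiEisenstein_meromorphic_exports_cm_two_of_letters` (X2_χ (A) at CM, this seat) — the scattering coordinates of `z ↦ (ν𝓕)⁻¹·M(z)φ` in a basis of
`V(χʷ, K′, ω)` are holomorphic on `{1 < Re}` as soon as every `z ↦ (M(z)φ)(g)` is (★ row 15 (i)).
HONEST LABEL: HC_CM is proved only modulo the 7 printed citations (2 remaining named inputs: hLiu418 = `stmt-HodgeConjecture-24832`, h413 = `stmt-HodgeConjecture-24833`) until rung 0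
closes; count-neutral helper, closes no socket.

## References
* [BernsteinLapid2019] J. Bernstein, E. Lapid, *On the meromorphic continuation of Eisenstein series*, J. Amer. Math. Soc. 37 (2024) (arXiv:1911.02342), §4 p. 10, §7 (the finite-dimensional parameter).
* [MoeglinWaldspurger1995] C. Mœglin, J.-L. Waldspurger, *Spectral Decomposition and Eisenstein Series* (1995), II.1.7, IV.1.9.
-/

set_option autoImplicit false
-- the mandated namespace repeats `HodgeConjecture.HodgeConjecture`, as in every `Theorems/*.lean` of this sub-problem
set_option linter.dupNamespace false

noncomputable section

open Matrix
open Literature.NumberTheory.EllipticCurves.ModularForms.PeriodRank (exists_finset_iInf_eq)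
open Literature.AlgebraicGeometry.Smoothening (exists_submatrix_det_ne_zero_of_linearIndependent)

namespace Summit.HodgeConjecture.HodgeConjecture.Cruxes.H413.K2E1LinearIndependentEvalMatrix

/-! ## §1 Evaluation points with invertible matrix -/

/-- **EVALUATION POINTS WITH NON-ZERO DETERMINANT**: for a linearly independent finite family `φ_j : X → 𝕜` over a field there are points `g_k` with `det (φ_j(g_k)) ≠ 0`.
[folklore] [cite: BernsteinLapid2019, §4 p. 10] -/
theorem exists_points_det_ne_zero {𝕜 X ι : Type*} [Field 𝕜] [Fintype ι] [DecidableEq ι] {φ : ι → X → 𝕜} (hli : LinearIndependent 𝕜 φ) :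
    ∃ g : ι → X, (Matrix.of fun j k : ι => φ j (g k)).det ≠ 0 := by
  classical
  -- the kernels of the evaluations on the coefficient space `ι → 𝕜`, and their trivial intersection
  obtain ⟨W, hW⟩ : ∃ W : X → Submodule 𝕜 (ι → 𝕜), W = fun x => LinearMap.ker (∑ j, φ j x • (LinearMap.proj j : (ι → 𝕜) →ₗ[𝕜] 𝕜)) := ⟨_, rfl⟩
  have hWmem : ∀ x (c : ι → 𝕜), c ∈ W x ↔ ∑ j, φ j x * c j = 0 := fun x c => by
    rw [hW, LinearMap.mem_ker, LinearMap.sum_apply]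
    simp only [LinearMap.smul_apply, LinearMap.proj_apply, smul_eq_mul]
  have hzero : ∀ c : ι → 𝕜, (∀ x, ∑ j, φ j x * c j = 0) → c = 0 := fun c hc => by
    funext j
    refine Fintype.linearIndependent_iff.1 hli c (funext fun x => ?_) j
    rw [Finset.sum_apply, Pi.zero_apply, ← hc x]
    exact Finset.sum_congr rfl fun j _ => by rw [Pi.smul_apply, smul_eq_mul, mul_comm]
  -- a finite set of points already detects (★ `exists_finset_iInf_eq` in the finite-dimensional `ι → 𝕜`)
  obtain ⟨s, hs⟩ := exists_finset_iInf_eq W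
  have hbot : ∀ c : ι → 𝕜, (∀ x ∈ s, ∑ j, φ j x * c j = 0) → c = 0 := fun c hc => by
    have hmem : c ∈ ⨅ x ∈ s, W x := (Submodule.mem_iInf _).2 fun x => (Submodule.mem_iInf _).2 fun hx => (hWmem x c).2 (hc x hx)
    rw [← hs, Submodule.mem_iInf] at hmem
    exact hzero c fun x => (hWmem x c).1 (hmem x)
  -- the `Fin m × Fin n` matrix of values and its independent rows
  obtain ⟨eι⟩ : Nonempty (ι ≃ Fin (Fintype.card ι)) := ⟨Fintype.equivFin ι⟩
  obtain ⟨M, hM⟩ : ∃ M : Matrix (Fin (Fintype.card ι)) (Fin s.card) 𝕜, M = Matrix.of fun i k => φ (eι.symm i) ((s.equivFin.symm k : ↥s) : X) := ⟨_, rfl⟩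
  have hrows : LinearIndependent 𝕜 M.row := by
    refine Fintype.linearIndependent_iff.2 fun c hc i => ?_
    have hc' : ∀ k : Fin s.card, ∑ i, c i * M i k = 0 := fun k => by
      have h := congrFun hc k
      simpa only [Finset.sum_apply, Pi.smul_apply, smul_eq_mul, Pi.zero_apply, Matrix.row, Matrix.row_apply] using h
    have hzero' : (fun j => c (eι j)) = 0 := by
      refine hbot _ fun x hx => ?_
      have h := hc' (s.equivFin ⟨x, hx⟩)
      rw [hM] at h
      simp only [Matrix.of_apply, Equiv.symm_apply_apply] at h
      rw [← h, ← eι.symm.sum_comp]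
      exact Finset.sum_congr rfl fun i _ => by rw [Equiv.apply_symm_apply, mul_comm]
    simpa only [Equiv.apply_symm_apply, Pi.zero_apply] using congrFun hzero' (eι.symm i)
  -- an invertible square minor (★ row rank = column rank), read back on `ι × ι`
  obtain ⟨a, -, hdet⟩ := exists_submatrix_det_ne_zero_of_linearIndependent M hrows
  refine ⟨fun k => ((s.equivFin.symm (a (eι k)) : ↥s) : X), ?_⟩
  have heq : (Matrix.of fun j k : ι => φ j ((s.equivFin.symm (a (eι k)) : ↥s) : X)) = Matrix.reindex eι.symm eι.symm (M.submatrix id a) := by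
    ext j k
    simp only [hM, Matrix.reindex_apply, Matrix.submatrix_apply, Matrix.of_apply, Equiv.symm_symm, id_eq, Equiv.symm_apply_apply]
  rw [heq, Matrix.det_reindex_self]
  exact hdet

/-! ## §2 Holomorphy of the coordinates of a pointwise-holomorphic family in the span -/

/-- **COORDINATES IN THE SPAN OF A LINEARLY INDEPENDENT FINITE FAMILY OF FUNCTIONS ARE HOLOMORPHIC WHEN THE VALUES ARE**: for `φ_j : X → ℂ` linearly independent (`j ∈ ι` finite) and
`v : ℂ → (X → ℂ)` with `v z ∈ span φ` for `z ∈ S` and every `z ↦ v z x` holomorphic on `S`, there are `q_j` holomorphic on `S` with `Σ_j q_j(z) φ_j = v z` on `S` (Cramer on the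
evaluation points of §1). [folklore] [cite: BernsteinLapid2019, §4 p. 10, §7] -/
theorem exists_coords_differentiableOn {X ι : Type*} [Fintype ι] [DecidableEq ι] {φ : ι → X → ℂ} (hli : LinearIndependent ℂ φ)
    {S : Set ℂ} {v : ℂ → X → ℂ} (hv : ∀ z ∈ S, v z ∈ Submodule.span ℂ (Set.range φ)) (hvd : ∀ x, DifferentiableOn ℂ (fun z => v z x) S) :
    ∃ q : ι → ℂ → ℂ, (∀ j, DifferentiableOn ℂ (q j) S) ∧ ∀ z ∈ S, (∑ j, q j z • φ j) = v z := by
  classical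
  obtain ⟨g, hdet⟩ := exists_points_det_ne_zero hli
  obtain ⟨M, hM⟩ : ∃ M : Matrix ι ι ℂ, M = Matrix.of fun j k : ι => φ j (g k) := ⟨_, rfl⟩
  rw [← hM] at hdet
  have hdetT : IsUnit Mᵀ.det := isUnit_iff_ne_zero.2 (by rwa [Matrix.det_transpose])
  -- the coordinates: `q(z) = (Mᵀ)⁻¹ (v z (g k))_k`
  refine ⟨fun j z => (Mᵀ⁻¹ *ᵥ fun k => v z (g k)) j, fun j => ?_, fun z hz => ?_⟩
  · have hq : (fun z => (Mᵀ⁻¹ *ᵥ fun k => v z (g k)) j) = fun z => ∑ k, Mᵀ⁻¹ j k * v z (g k) := by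
      funext z
      simp only [Matrix.mulVec, dotProduct]
    show DifferentiableOn ℂ (fun z => (Mᵀ⁻¹ *ᵥ fun k => v z (g k)) j) S
    rw [hq]
    exact DifferentiableOn.fun_sum fun k _ => (hvd (g k)).const_mul _
  · obtain ⟨c, hc⟩ := (Submodule.mem_span_range_iff_exists_fun ℂ).1 (hv z hz)
    -- the values at the evaluation points: `(v z (g k))_k = Mᵀ c`
    have hval : (fun k => v z (g k)) = Mᵀ *ᵥ c := by
      funext k
      rw [← hc]
      simp only [Finset.sum_apply, Pi.smul_apply, smul_eq_mul, Matrix.mulVec, dotProduct, Matrix.transpose_apply, hM, Matrix.of_apply]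
      exact Finset.sum_congr rfl fun j _ => mul_comm _ _
    have hsolve : (Mᵀ⁻¹ *ᵥ fun k => v z (g k)) = c := by
      rw [hval, Matrix.mulVec_mulVec, Matrix.nonsing_inv_mul _ hdetT, Matrix.one_mulVec]
    rw [← hc]
    exact Finset.sum_congr rfl fun j _ => by
      show (Mᵀ⁻¹ *ᵥ fun k => v z (g k)) j • φ j = c j • φ j
      rw [hsolve]

end Summit.HodgeConjecture.HodgeConjecture.Cruxes.H413.K2E1LinearIndependentEvalMatrix

end
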